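import Literature.AlgebraicGeometry.Motives.LinesGenerateChowOne
import Literature.AlgebraicGeometry.Motives.CyclesAbelianVarietiesProofs
import Literature.AlgebraicGeometry.Motives.VarietiesQuasiCompactProofs
import Mathlib.LinearAlgebra.Matrix.ToLinearEquiv
import Mathlib.LinearAlgebra.FiniteDimensional.Lemmas
import HarnessLib

/-!
# `CH₁` generated by lines (Tian–Zong 2014, Thm. 1.7): the reduction to irreducible curves and
# the degenerate cases of relative dimension `≤ 1`

Z. Tian, H. R. Zong, *One-cycles on rationally connected varieties*, Compositio Math. **150**
(2014) 396–408 = arXiv:1209.4342 [TianZong2014], Theorem 1.7 (proved as Theorem 6.1, §6), is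
vendored in `Motives/LinesGenerateChowOne` as the named fact
`Literature.AlgebraicGeometry.Motives.TianZong2014_chowOne_generatedByLines` (characteristic `0`).
This file proves, sorry-free and without any new named fact, the first steps of its proof on the
tree's carriers:

* **Cycles are finite sums of prime cycles; `CH_d` is generated by subvarieties.** On a compact
  scheme a cycle has finite support and equals `Σ_z c(z)·[closure {z}]`
  (`finite_support_of_compactSpace`, `eq_sum_smul_primeCycle_of_support_subset`), so any subgroup
  of `CH_d(Y)` containing the classes `[closure {z}]` of all `d`-dimensional points is everything
  (`ChowGroup.eq_top_of_forall_ofPoint_mem`; Fulton, *Intersection Theory*, §1.3: "a `k`-cycle on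
  `X` is a finite formal sum `Σ nᵢ [Vᵢ]`").
* **Reduction to irreducible curves** — the opening move of the printed proof of Thm. 6.1 / Prop.
  3.1 ("Fix an irreducible curve `C` in `X`", arXiv p. 6): `ChowOneGeneratedByLines N i` holds as
  soon as every prime `1`-cycle `[closure {z}]`, `dim closure {z} = 1`, is rationally equivalent to
  an integral combination of lines (`ChowOneGeneratedByLines.of_primeCycle`,
  `chowOneGeneratedByLines_iff_forall_primeCycle`), and accordingly the named fact follows from
  its prime-cycle case (`TianZong2014_chowOne_generatedByLines_of_forall_primeCycle`; compactness of
  a smooth projective variety is `IsSmoothProjective.compactSpace_holds`).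
* **Linear forms under the Jacobian condition are linearly independent**
  (`linearIndependent_of_isNonsingularSystem_of_isHomogeneous_one`): if fewer than the number of
  variables linear forms `F_a` satisfy `IsNonsingularSystem` then they are linearly independent —
  otherwise every maximal Jacobian minor (a minor of the constant coefficient matrix) vanishes, and
  the prime ideal of polynomials vanishing at a non-zero common zero of the `F_a` violates the
  condition (Hartshorne I Ex. 5.8: the rank condition of the Jacobian criterion).
* **The degenerate cases `n ≤ 1` of Thm. 1.7** (`TianZong2014_chowOne_generatedByLines_of_le_one`):
  for `n = 0` the degree condition `Σ dᵢ + 1 ≤ c` contradicts `dᵢ ≥ 1`; for `n = 1` it forces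
  `dᵢ = 1` for all `i`, so `X ⊆ ℙ¹⁺ᶜ` is cut out by `c` linearly independent linear forms, i.e. `X`
  is itself a line: its generic point is a line point (`IsLinePoint`), it is the only point of
  dimension `1` (`IsSmoothProjective.height_eq_iff`), and every `1`-cycle is a multiple of `[X]`.
  This case needs neither algebraic closedness nor characteristic `0`, and it certifies that the
  rendering `IsLinePoint` of "line" is inhabited in the intended way.

What is NOT here (recorded in the seat's notes): the cases `n ≥ 2`, i.e. the content of the
theorem — rational chain connectedness by lines of the Fano scheme (Kollár V.4.8.1), the surjection
`CH₀(F(X)) ⊗ ℚ ↠ CH₁(X) ⊗ ℚ` (Kollár IV.3.13.3), divisibility of `CH₁(X)_alg` (Bloch–Ogus), the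
main theorem 1.3 via Kontsevich stable maps and the irreducibility of `M̄_g`, and Thm. 6.2
(rational curves degenerate to sums of lines); none of this theory exists in Mathlib or the tree.

## References

* [TianZong2014] Z. Tian, H. R. Zong, *One-cycles on rationally connected varieties*, Compositio
  Math. 150 (2014) 396–408, doi:10.1112/S0010437X13007549 = arXiv:1209.4342: Thm. 1.7 (p. 3),
  Thm. 6.1 and its proof (§6, p. 9), Prop. 3.1 (p. 6).
* [Fulton1998] W. Fulton, *Intersection Theory*, 2nd ed. (1998), §1.3.
* [Hartshorne1977] R. Hartshorne, *Algebraic Geometry* (1977), I Ex. 5.8, II Ex. 8.4.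
-/

noncomputable section

open CategoryTheory AlgebraicGeometry Order

universe u

namespace Literature.AlgebraicGeometry.Motives

-- No `attribute [local instance] MvPolynomial.gradedAlgebra` here: the two statements that
-- mention `V₊(F) = ProjectiveSpectrum.zeroLocus …` supply the grading by an inline `letI`, which
-- elaborates to the very same terms as in `Motives/LinesGenerateChowOne`.

/-! ### Cycles on a compact scheme; `CH_d` is generated by the classes of subvarieties -/

section Generation

variable {Y : Scheme.{u}}

/-- On a (quasi-)compact scheme an algebraic cycle has finite support (its support is locally
finite, Mathlib `Function.locallyFinsupp`; Fulton, *Intersection Theory*, §1.3: cycles are finite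
formal sums). [cite: Fulton1998, §1.3] -/
theorem finite_support_of_compactSpace [CompactSpace Y] (c : AlgebraicCycle Y ℤ) :
    (Function.support c).Finite := by
  simpa using c.locallyFiniteSupport.finite_inter_support_of_isCompact isCompact_univ

/-- A cycle whose support lies in a finite set `s` is the sum over `s` of its prime cycles with
multiplicities: `c = Σ_{z ∈ s} c(z) · [closure {z}]` (Fulton §1.3, "a `k`-cycle is a finite formal
sum `Σ nᵢ [Vᵢ]`"). (The same statement with the hypothesis spelled `∀ z, c z ≠ 0 → z ∈ S` is
`eq_sum_smul_primeCycle` of `Motives/GeneralisedDecompositionOfTheDiagonalProofs`, not imported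
here to keep the import graph of this file small.) [cite: Fulton1998, §1.3] -/
theorem eq_sum_smul_primeCycle_of_support_subset (c : AlgebraicCycle Y ℤ) {s : Finset Y}
    (hs : Function.support c ⊆ (s : Set Y)) : c = ∑ z ∈ s, c z • primeCycle z := by
  classical
  ext y
  simp only [Function.locallyFinsuppWithin.coe_sum, Finset.sum_apply,
    Function.locallyFinsuppWithin.coe_zsmul, Pi.smul_apply, smul_eq_mul]
  by_cases hy : y ∈ s
  · rw [Finset.sum_eq_single y, primeCycle_apply_self, mul_one]
    · intro z _ hzy
      rw [primeCycle_apply_of_ne (Ne.symm hzy), mul_zero]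
    · exact fun h ↦ (h hy).elim
  · rw [Finset.sum_eq_zero]
    · by_contra h
      exact hy (hs (Function.mem_support.mpr h))
    · intro z hz
      rw [primeCycle_apply_of_ne, mul_zero]
      rintro rfl
      exact hy hz

/-- **`CH_d(Y)` is generated by the classes of the `d`-dimensional subvarieties** (compact `Y`):
a subgroup of `CH_d(Y)` containing the class `[closure {z}]` (`ChowGroup.ofPoint z _`) of every
point `z` of dimension `d` is all of `CH_d(Y)` — every `d`-cycle is a finite integral combination
of prime cycles of `d`-dimensional points (Fulton, *Intersection Theory*, §1.3: `Z_k X` is the free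
abelian group on the `k`-dimensional subvarieties and `A_k X` its quotient). [cite: Fulton1998, §1.3] -/
theorem ChowGroup.eq_top_of_forall_ofPoint_mem [CompactSpace Y] {d : ℕ}
    {H : AddSubgroup (ChowGroup Y d)}
    (h : ∀ (z : Y) (hz : Order.height z = d), ChowGroup.ofPoint z hz ∈ H) : H = ⊤ := by
  classical
  rw [eq_top_iff]
  rintro x -
  induction x using ChowGroup.induction_on with
  | h γ =>
    set s := (finite_support_of_compactSpace (γ : AlgebraicCycle Y ℤ)).toFinset with hs_def
    have hs : Function.support (γ : AlgebraicCycle Y ℤ) ⊆ (s : Set Y) := by simp [hs_def]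
    have hmem : ∀ z ∈ s, (γ : AlgebraicCycle Y ℤ) z ≠ 0 := fun z hz ↦ by simpa [hs_def] using hz
    have hγ : γ = ∑ z ∈ s.attach, (γ : AlgebraicCycle Y ℤ) z •
        (⟨primeCycle (z : Y), primeCycle_mem_cyclesOfDim (γ.2 z (hmem z z.2))⟩ :
          ↥(cyclesOfDim Y d)) := by
      apply Subtype.ext
      rw [AddSubgroup.val_finsetSum]
      simp only [AddSubgroup.coe_zsmul]
      rw [Finset.sum_attach s fun z ↦ (γ : AlgebraicCycle Y ℤ) z • primeCycle z]
      exact eq_sum_smul_primeCycle_of_support_subset _ hs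
    rw [hγ, map_sum]
    refine AddSubgroup.sum_mem _ fun z _ ↦ ?_
    rw [map_zsmul]
    exact AddSubgroup.zsmul_mem _ (h z (γ.2 z (hmem z z.2))) _

end Generation

/-! ### Reduction of "`CH₁(X)` is generated by lines" to irreducible curves -/

section Lines

variable {k : Type u} [Field k] {N : ℕ} {X : SchemeOver k} {i : X ⟶ projectiveSpace N k}

/-- Chow-group form of the reduction: on a compact `X`, if the class of every one-dimensional
closed subvariety `closure {z}` lies in the subgroup of `CH₁(X)` generated by the line classes,
that subgroup is all of `CH₁(X)`. [cite: Fulton1998, §1.3] -/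
theorem closure_lineClasses_eq_top_of_forall_ofPoint_mem [CompactSpace ↥X.left]
    (h : ∀ (z : ↥X.left) (hz : Order.height z = ((1 : ℕ) : ℕ∞)),
      ChowGroup.ofPoint z hz ∈ AddSubgroup.closure (lineClasses N i)) :
    AddSubgroup.closure (lineClasses N i) = ⊤ :=
  ChowGroup.eq_top_of_forall_ofPoint_mem h

/-- **Reduction to irreducible curves** (the opening step "Fix an irreducible curve `C` in `X`" of
the proofs of Tian–Zong, Prop. 3.1 and Thm. 6.1): on a compact embedded `k`-scheme `i : X ⟶ ℙᴺ`,
if every prime `1`-cycle `[closure {z}]` (`dim closure {z} = 1`) is rationally equivalent, as a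
`1`-cycle, to an integral combination of prime cycles of lines, then `CH₁(X)` is generated by
lines (`ChowOneGeneratedByLines N i`). [cite: TianZong2014, proof of Prop. 3.1 and Thm. 6.1] -/
theorem ChowOneGeneratedByLines.of_primeCycle [CompactSpace ↥X.left]
    (h : ∀ z : ↥X.left, Order.height z = 1 → ∃ (s : Finset ↥X.left) (w : ↥X.left → ℤ),
      (∀ y ∈ s, IsLinePoint N i y) ∧
        IsRationallyEquivalent (primeCycle z) (∑ y ∈ s, w y • primeCycle y) 1) :
    ChowOneGeneratedByLines N i := by
  refine chowOneGeneratedByLines_of_closure_lineClasses_eq_top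
    (closure_lineClasses_eq_top_of_forall_ofPoint_mem fun z hz ↦ ?_)
  obtain ⟨s, w, hs, hrat⟩ := h z (by simpa using hz)
  have hmk : ChowGroup.ofPoint z hz =
      ChowGroup.mk X.left 1 ⟨_, sum_zsmul_primeCycle_mem_cyclesOfDim w hs⟩ :=
    ChowGroup.mk_eq_mk_iff.mpr hrat
  rw [hmk]
  exact mk_sum_zsmul_primeCycle_mem_closure_lineClasses w hs

/-- The converse (trivial) direction: if `CH₁(X)` is generated by lines then in particular every
prime `1`-cycle is rationally equivalent to an integral combination of lines. [folklore] -/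
theorem ChowOneGeneratedByLines.exists_of_height_eq_one (h : ChowOneGeneratedByLines N i)
    {z : ↥X.left} (hz : Order.height z = 1) :
    ∃ (s : Finset ↥X.left) (w : ↥X.left → ℤ), (∀ y ∈ s, IsLinePoint N i y) ∧
      IsRationallyEquivalent (primeCycle z) (∑ y ∈ s, w y • primeCycle y) 1 :=
  h _ (primeCycle_mem_cyclesOfDim (by simpa using hz))

/-- On a compact embedded `k`-scheme, `CH₁(X)` is generated by lines iff every prime `1`-cycle is
rationally equivalent to an integral combination of lines.
[cite: TianZong2014, proof of Prop. 3.1 and Thm. 6.1] -/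
theorem chowOneGeneratedByLines_iff_forall_primeCycle [CompactSpace ↥X.left] :
    ChowOneGeneratedByLines N i ↔
      ∀ z : ↥X.left, Order.height z = 1 → ∃ (s : Finset ↥X.left) (w : ↥X.left → ℤ),
        (∀ y ∈ s, IsLinePoint N i y) ∧
          IsRationallyEquivalent (primeCycle z) (∑ y ∈ s, w y • primeCycle y) 1 :=
  ⟨fun h _ hz ↦ h.exists_of_height_eq_one hz, ChowOneGeneratedByLines.of_primeCycle⟩

/-- **Tian–Zong Thm. 1.7 follows from its prime-cycle case.** If, for every smooth complete
intersection `X ⊆ ℙⁿ⁺ᶜ_k` as in `TianZong2014_chowOne_generatedByLines`, every irreducible curve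
`closure {z} ⊆ X` is rationally equivalent to an integral combination of lines, then the named
fact holds (a smooth projective variety is compact, `IsSmoothProjective.compactSpace_holds`, and
`ChowOneGeneratedByLines.of_primeCycle`). [cite: TianZong2014, Thm. 1.7 and proof of Thm. 6.1] -/
theorem TianZong2014_chowOne_generatedByLines_of_forall_primeCycle
    (h : ∀ ⦃k : Type u⦄ [Field k] [IsAlgClosed k] [CharZero k] ⦃c : ℕ⦄ (n : ℕ) (d : Fin c → ℕ)
      ⦃X : SchemeOver k⦄ (F : Fin c → MvPolynomial (Fin (n + c + 1)) k)
      (i : X ⟶ projectiveSpace (n + c) k),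
      letI := MvPolynomial.gradedAlgebra (σ := Fin (n + c + 1)) (R := k)
      IsSmoothProjective n X → (∀ a, (F a).IsHomogeneous (d a)) → (∀ a, 0 < d a) →
        IsNonsingularSystem k F → IsClosedImmersion i.left →
          Set.range i.left.base =
            ProjectiveSpectrum.zeroLocus (MvPolynomial.homogeneousSubmodule (Fin (n + c + 1)) k)
              (Set.range F) →
            (∑ a, d a) + 1 ≤ n + c →
              ∀ z : ↥X.left, Order.height z = 1 → ∃ (s : Finset ↥X.left) (w : ↥X.left → ℤ),
                (∀ y ∈ s, IsLinePoint (n + c) i y) ∧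
                  IsRationallyEquivalent (primeCycle z) (∑ y ∈ s, w y • primeCycle y) 1) :
    TianZong2014_chowOne_generatedByLines.{u} := by
  intro k _ _ _ c n d X F i hX hF hd hJ hi hV hdeg
  haveI : CompactSpace ↥X.left := IsSmoothProjective.compactSpace_holds hX
  exact ChowOneGeneratedByLines.of_primeCycle (h n d F i hX hF hd hJ hi hV hdeg)

end Lines

/-! ### Linear forms satisfying the Jacobian condition are linearly independent -/

section LinearForms

open _root_.MvPolynomial

variable {k : Type u} [Field k] {σ : Type*} [Fintype σ]

/-- A linear form is the sum of its coefficients times the variables: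
`f = Σ_p coeff_{e_p}(f) · X_p` for `f` homogeneous of degree `1`. [folklore] -/
private theorem sum_coeff_single_smul_X_of_isHomogeneous_one {f : MvPolynomial σ k}
    (hf : f.IsHomogeneous 1) :
    ∑ p, coeff (Finsupp.single p 1) f • (X p : MvPolynomial σ k) = f := by
  classical
  ext d
  simp only [coeff_sum, coeff_smul, coeff_X, smul_eq_mul, mul_ite, mul_one, mul_zero]
  by_cases hd : ∃ p, Finsupp.single p 1 = d
  · obtain ⟨p, rfl⟩ := hd
    rw [Finset.sum_eq_single p (fun q _ hq => if_neg fun h =>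
      hq (Finsupp.single_left_injective one_ne_zero h)) (fun h => absurd (Finset.mem_univ p) h),
      if_pos rfl]
  · rw [Finset.sum_eq_zero fun p _ => if_neg fun h => hd ⟨p, h⟩]
    refine (hf.coeff_eq_zero fun hdeg => hd ?_).symm
    obtain ⟨p, hp⟩ := (Finsupp.sum_eq_one_iff d).mp hdeg
    exact ⟨p, hp.symm⟩

/-- Evaluation of a linear form is linear in the point: `f(v) = Σ_p coeff_{e_p}(f) v_p`.
[folklore] -/
private theorem eval_eq_sum_coeff_mul_of_isHomogeneous_one {f : MvPolynomial σ k}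
    (hf : f.IsHomogeneous 1) (v : σ → k) :
    eval v f = ∑ p, coeff (Finsupp.single p 1) f * v p := by
  conv_lhs => rw [← sum_coeff_single_smul_X_of_isHomogeneous_one hf]
  simp [map_sum, smul_eval, eval_X]

/-- **Linear forms under the Jacobian condition are linearly independent.** If a family of fewer
than `#σ` linear forms `F_a ∈ k[x_σ]` satisfies the Jacobian condition `IsNonsingularSystem`
(every prime containing the `F_a` and the maximal Jacobian minors contains all variables), then
it is linearly independent: for a dependent family every maximal minor of the (constant) Jacobian
matrix vanishes, and the prime ideal of polynomials vanishing at a non-zero common zero `v` of the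
`F_a` (which exists, fewer equations than unknowns) contains the `F_a` and the minors but not all
the variables. This is the rank condition of the projective Jacobian criterion for a linear
subspace (Hartshorne I Ex. 5.8). [cite: Hartshorne1977, I Ex. 5.8] -/
theorem linearIndependent_of_isNonsingularSystem_of_isHomogeneous_one {ι : Type*} [Fintype ι]
    [DecidableEq ι] {F : ι → MvPolynomial σ k} (hF : ∀ a, (F a).IsHomogeneous 1)
    (hJ : IsNonsingularSystem k F) (hcard : Fintype.card ι < Fintype.card σ) :
    LinearIndependent k F := by
  classical
  by_contra hli
  obtain ⟨g, hg, a₀, ha₀⟩ := Fintype.not_linearIndependent_iff.mp hli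
  -- (1) every maximal Jacobian minor vanishes: the rows of the Jacobian matrix are dependent
  have hminor : ∀ r : ι → σ, jacobianMinor F r = 0 := by
    intro r
    rw [jacobianMinor]
    refine Matrix.exists_vecMul_eq_zero_iff.mp ⟨fun a ↦ C (g a), ?_, ?_⟩
    · intro h0
      apply ha₀
      have h1 := congr_fun h0 a₀
      simpa using h1
    · funext b
      simp only [Matrix.vecMul, dotProduct, Matrix.of_apply, Pi.zero_apply]
      calc ∑ a, C (g a) * pderiv (r b) (F a) = pderiv (r b) (∑ a, g a • F a) := by
            rw [map_sum]
            refine Finset.sum_congr rfl fun a _ ↦ ?_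
            rw [smul_eq_C_mul, pderiv_C_mul]
        _ = 0 := by rw [hg, map_zero]
  -- (2) a non-zero common zero `v` of the linear forms (fewer equations than unknowns)
  let A : Matrix ι σ k := Matrix.of fun a p ↦ coeff (Finsupp.single p 1) (F a)
  have hker : LinearMap.ker A.mulVecLin ≠ ⊥ :=
    LinearMap.ker_ne_bot_of_finrank_lt (by simpa using hcard)
  obtain ⟨v, hv, hv0⟩ := Submodule.exists_mem_ne_zero_of_ne_bot hker
  have heval : ∀ a, eval v (F a) = 0 := by
    intro a
    have h1 := congr_fun (LinearMap.mem_ker.mp hv) a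
    rw [eval_eq_sum_coeff_mul_of_isHomogeneous_one (hF a)]
    simpa [Matrix.mulVec, dotProduct, A] using h1
  -- (3) the prime of polynomials vanishing at `v` contradicts the Jacobian condition
  have hprime : (RingHom.ker (eval v)).IsPrime := RingHom.ker_isPrime _
  have hXmem := hJ (RingHom.ker (eval v)) hprime (fun a ↦ (RingHom.mem_ker).mpr (heval a))
    (fun r ↦ by rw [hminor r]; exact Ideal.zero_mem _)
  apply hv0
  funext p
  have h1 := hXmem p
  rwa [RingHom.mem_ker, eval_X] at h1

end LinearForms

/-! ### The degenerate cases `n ≤ 1` of Tian–Zong, Thm. 1.7 -/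

section DegenerateCases

variable {k : Type u} [Field k]

/-- `c ≤ Σ dᵢ` when all `dᵢ ≥ 1`. [folklore] -/
private theorem card_le_sum_of_forall_pos {c : ℕ} {d : Fin c → ℕ} (hd : ∀ a, 0 < d a) :
    c ≤ ∑ a, d a :=
  calc c = ∑ _a : Fin c, 1 := by simp
    _ ≤ ∑ a, d a := Finset.sum_le_sum fun a _ ↦ hd a

/-- If `dᵢ ≥ 1` for all `i` and `Σ dᵢ ≤ c` then all `dᵢ = 1`. [folklore] -/
private theorem eq_one_of_forall_pos_of_sum_le {c : ℕ} {d : Fin c → ℕ} (hd : ∀ a, 0 < d a)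
    (h : ∑ a, d a ≤ c) (a : Fin c) : d a = 1 := by
  by_contra hne
  have hlt : ∑ _a : Fin c, 1 < ∑ a, d a :=
    Finset.sum_lt_sum (fun a _ ↦ hd a) ⟨a, Finset.mem_univ _, lt_of_le_of_ne (hd a) (Ne.symm hne)⟩
  simp only [Finset.sum_const, Finset.card_univ, Fintype.card_fin, smul_eq_mul, mul_one] at hlt
  omega

/-- **Tian–Zong 2014, Thm. 1.7, in relative dimension `n ≤ 1`** (the degenerate cases of the
printed theorem, over any field and in any characteristic). Hypotheses as in the named fact
`TianZong2014_chowOne_generatedByLines` (the closed-immersion, algebraic-closedness and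
characteristic hypotheses are not needed here). For `n = 0` the degree bound `Σ dᵢ + 1 ≤ c`
contradicts `dᵢ ≥ 1`. For `n = 1` it forces all `dᵢ = 1`: `X ⊆ ℙ¹⁺ᶜ` is cut out by `c` linear
forms, linearly independent by the Jacobian condition
(`linearIndependent_of_isNonsingularSystem_of_isHomogeneous_one`), so the generic point `η` of the
irreducible one-dimensional `X` is a line point (`IsLinePoint`: `dim closure {η} = 1` by
`IsSmoothProjective.height_genericPoint`, image `V₊(F₁, …, F_c)`), it is the only point of
dimension `1` (`IsSmoothProjective.height_eq_iff`), and every `1`-cycle `γ` equals `γ(η) · [X]`.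
[cite: TianZong2014, Thm. 1.7 (= Thm. 6.1), case dim X ≤ 1] -/
theorem TianZong2014_chowOne_generatedByLines_of_le_one {c : ℕ} (n : ℕ) (hn : n ≤ 1)
    (d : Fin c → ℕ) {X : SchemeOver k} (F : Fin c → MvPolynomial (Fin (n + c + 1)) k)
    (i : X ⟶ projectiveSpace (n + c) k) (hX : IsSmoothProjective n X)
    (hF : ∀ a, (F a).IsHomogeneous (d a)) (hd : ∀ a, 0 < d a) (hJ : IsNonsingularSystem k F)
    (hV : letI := MvPolynomial.gradedAlgebra (σ := Fin (n + c + 1)) (R := k)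
      Set.range i.left.base =
        ProjectiveSpectrum.zeroLocus (MvPolynomial.homogeneousSubmodule (Fin (n + c + 1)) k)
          (Set.range F))
    (hdeg : (∑ a, d a) + 1 ≤ n + c) : ChowOneGeneratedByLines (n + c) i := by
  have hc : c ≤ ∑ a, d a := card_le_sum_of_forall_pos hd
  obtain rfl | rfl : n = 0 ∨ n = 1 := by omega
  · exfalso
    omega
  · have hd1 : ∀ a, d a = 1 := eq_one_of_forall_pos_of_sum_le hd (by omega)
    have hF1 : ∀ a, (F a).IsHomogeneous 1 := fun a ↦ by simpa [hd1 a] using hF a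
    have hli : LinearIndependent k F :=
      linearIndependent_of_isNonsingularSystem_of_isHomogeneous_one hF1 hJ (by simp)
    haveI := hX.geometricallyIrreducible
    haveI : IrreducibleSpace ↥X.left :=
      GeometricallyIrreducible.irreducibleSpace_of_subsingleton X.hom
    have hη : Order.height (genericPoint ↥X.left) = ((1 : ℕ) : ℕ∞) := hX.height_genericPoint
    have hce : 1 + c - 1 = c := by omega
    -- the generic point of `X` is (the generic point of) a line of `X ⊆ ℙ¹⁺ᶜ`
    have hline : IsLinePoint (1 + c) i (genericPoint ↥X.left) := by
      refine ⟨by simpa using hη, fun j ↦ F (finCongr hce j), ?_, fun j ↦ hF1 _, ?_⟩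
      · exact hli.comp _ (finCongr hce).injective
      · rw [genericPoint_closure, Set.image_univ, hV]
        congr 1
        exact ((finCongr hce).surjective.range_comp F).symm
    intro γ hγ
    refine ⟨{genericPoint ↥X.left}, fun _ ↦ γ (genericPoint ↥X.left), by simpa using hline, ?_⟩
    -- every `1`-cycle is supported at the generic point
    have hsupp : Function.support γ ⊆
        (({genericPoint ↥X.left} : Finset ↥X.left) : Set ↥X.left) := by
      intro z hz
      simp only [Finset.coe_singleton, Set.mem_singleton_iff]
      exact hX.height_eq_iff.mp (hγ z hz)
    have hγeq := eq_sum_smul_primeCycle_of_support_subset γ hsupp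
    rw [Finset.sum_singleton] at hγeq ⊢
    rw [← hγeq]
    exact IsRationallyEquivalent.refl γ

end DegenerateCases

end Literature.AlgebraicGeometry.Motives

end
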